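import Summits.SmoothPoincare4.SmoothPoincare4.Theorems.CylinderEntropyCylinderRungTwoNullSurvivorsDieOfStatic
import HarnessLib

/-!
# Route `CylinderEntropy`, crux `CylinderRungTwo` (stmt-SmoothPoincare4-7631), line `killing-flux`:
# NULL SURVIVORS WITH A POCKET DIE (lead reshape r19, the glue)

Registered helper `helper_nullSurvivorsDieOfPocket` (lead c7, wave 1b).  After r18 the null-survivor branch of the
research stub of the line was killed by the LANDED glue `helper_nullSurvivorsDieOfStatic`
(`Theorems/CylinderEntropyCylinderRungTwoNullSurvivorsDieOfStatic.lean`): from the static degree-zero lemma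
`NullThinStatic` there is no immortal smooth cylinder flow `IsCylinderMCF P F ν T` of a compact connected
cross-section of `N = S⁴ × ℝ = {z ∈ ℝ⁶ | ∑_{i<5} zᵢ² = 1}` with cylinder entropy `λ_cyl < 2` along the flow whose
slices never separate the two ends of `N` AND CARRY ZERO VERTICAL FLUX `∫ ν₅ d((F t)^*μH⁴) = 0`.

Reshape r19 states that branch purely path-topologically: the slices never separate the ends AND the complement
`N ∖ F_t(P)` of every slice has a POCKET — a point of `N ∖ F_t(P)` that cannot be joined inside `N ∖ F_t(P)` to
any point of height `≤ -R`.  The zero-flux clause is then SUPPLIED by the wave-1b brick `FluxZeroOfPocket`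
(a non-separating compact connected embedded cross-section with a pocket, and any continuous unit normal field
along it tangent to `N`, has `∫ ν₅ d(ι^*μH⁴) = 0`), taken here verbatim as the second hypothesis.

* **`helper_nullSurvivorsDieOfPocket : NullThinStatic → FluxZeroOfPocket → ¬ ∃ (pocketed non-separating null
  survivor)`** — pure logic over the definitions: destructure the flow, feed the SAME data to
  `helper_nullSurvivorsDieOfStatic`, and produce the flux clause at each time `t ≥ T` from `FluxZeroOfPocket`
  applied to the slice `F t` (a smooth embedding into `N` by `IsCylinderMCF.isSmoothEmbedding`/`mem_cyl`), its
  non-separation UNFOLDED (`SeparatesEnds`, `cylN` are the typed predicates of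
  `Theorems/CylinderEntropyCylinderRungTwoKillingFluxDefs.lean`; the private bridge
  `forall_joinedIn_of_not_separatesEnds` is their `by_contra` negation), the pocket, and the normal `ν t`
  (continuous as `ContMDiff`, unit normal, tangent to `N` by the `IsCylinderMCF` fields).

No `sorry`, no new definition, no named fact.
-/

noncomputable section

-- the prescribed namespace `Summit.SmoothPoincare4.SmoothPoincare4.…` repeats `SmoothPoincare4`
set_option linter.dupNamespace false

open MeasureTheory Set Filter
open scoped Manifold ContDiff ENNReal Topology BigOperators

namespace Summit.SmoothPoincare4.SmoothPoincare4.Cruxes.CylinderRungTwo.KillingFlux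

open Literature.Geometry.Riemannian
open Literature.Geometry.Lorentzian Literature.Geometry.Lorentzian.PseudoRiemannianMetric
open Literature.Geometry.Riemannian.SphericalCylinderEntropy

/-- Bridge: NOT separating the ends of `N`, unfolded — for every `R` some point of `N` of height `≤ -R` is
joined inside `N ∖ A` to some point of `N` of height `≥ R` (the typed `SeparatesEnds`/`cylN` of the line's
vocabulary, negated by `by_contra`; `cylN` unfolds definitionally). [folklore] -/
private theorem forall_joinedIn_of_not_separatesEnds {A : Set (EuclideanSpace ℝ (Fin 6))}
    (h : ¬ SeparatesEnds A) (R : ℝ) :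
    ∃ a b : EuclideanSpace ℝ (Fin 6), ∑ i : Fin 5, a (Fin.castSucc i) ^ 2 = 1 ∧
      ∑ i : Fin 5, b (Fin.castSucc i) ^ 2 = 1 ∧ a 5 ≤ -R ∧ R ≤ b 5 ∧
      JoinedIn ({z : EuclideanSpace ℝ (Fin 6) | ∑ i : Fin 5, z (Fin.castSucc i) ^ 2 = 1} \ A) a b := by
  by_contra hR
  exact h ⟨R, fun a b ha hb haR hRb hj => hR ⟨a, b, ha, hb, haR, hRb, hj⟩⟩

/-- **Registered helper `helper_nullSurvivorsDieOfPocket` (lead reshape r19 of line `killing-flux`): POCKETED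
NON-SEPARATING NULL SURVIVORS DIE.**  Hypotheses, verbatim: `NullThinStatic` (the static degree-zero lemma, the
hypothesis of the landed glue `helper_nullSurvivorsDieOfStatic`) and `FluxZeroOfPocket` (a compact connected
embedded cross-section of `N` that does not separate the ends and whose complement has a pocket has zero
vertical flux for every continuous unit normal field tangent to `N`).  Conclusion: there is no immortal smooth
cylinder flow `IsCylinderMCF P F ν T` of a compact connected cross-section with `λ_cyl < 2` along the flow whose
slices never separate the ends of `N` and always have a pocket.  Proof: `helper_nullSurvivorsDieOfStatic` on the
same flow, the flux clause at each `t ≥ T` being `FluxZeroOfPocket` at the slice `F t` with normal `ν t`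
(embedding into `N`, unfolded non-separation, pocket, continuity/unit-normality/tangency from the
`IsCylinderMCF` fields). [folklore] -/
theorem helper_nullSurvivorsDieOfPocket :
    (∀ δ : ℝ, 0 < δ → ∀ B : ℝ, ∃ ε : ℝ, 0 < ε ∧
      ∀ (M : Type) [TopologicalSpace M] [T2Space M] [SecondCountableTopology M]
        [ChartedSpace (EuclideanSpace ℝ (Fin 4)) M] [IsManifold (𝓡 4) ∞ M] [CompactSpace M]
        [ConnectedSpace M] [MeasurableSpace M] [BorelSpace M]
        (ι ν : M → EuclideanSpace ℝ (Fin 6)),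
        Manifold.IsSmoothEmbedding (𝓡 4) (𝓡 6) ∞ ι →
        (∀ x, ∑ i : Fin 5, ι x (Fin.castSucc i) ^ 2 = 1) →
        ¬ SeparatesEnds (Set.range ι) →
        ∀ himm : (euclideanMetric (EuclideanSpace ℝ (Fin 6))).IsSpacelikeImmersion (𝓡 4) ι,
        (euclideanMetric (EuclideanSpace ℝ (Fin 6))).IsUnitNormal (𝓡 4) ι ν 1 →
        (∀ x, ∑ i : Fin 5, ν x (Fin.castSucc i) * ι x (Fin.castSucc i) = 0) →
        ContMDiff (𝓡 4) (𝓡 6) ∞ ν →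
        (∀ x, |ι x 5| ≤ B) →
        cylEntropy (Set.range ι) ≤ ENNReal.ofReal (2 - δ) →
        μH[4] (Metric.sphere (0 : EuclideanSpace ℝ (Fin 5)) 1) ≤ μH[4] (Set.range ι) →
        ∫⁻ x, ENNReal.ofReal (1 - ν x 5 ^ 2)
            ∂(Measure.comap ι (μH[4] : Measure (EuclideanSpace ℝ (Fin 6)))) ≤ ENNReal.ofReal ε →
        ∫⁻ x, ENNReal.ofReal
            ((euclideanMetric (EuclideanSpace ℝ (Fin 6))).meanCurvature ι contMDiff_pullbackBilin_holds himm ν x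
              ^ 2) ∂(Measure.comap ι (μH[4] : Measure (EuclideanSpace ℝ (Fin 6)))) ≤ ENNReal.ofReal ε →
        ∫ x, ν x 5 ∂(Measure.comap ι (μH[4] : Measure (EuclideanSpace ℝ (Fin 6)))) = 0 →
        False) →
    (∀ (M : Type) [TopologicalSpace M] [T2Space M] [SecondCountableTopology M]
        [ChartedSpace (EuclideanSpace ℝ (Fin 4)) M] [IsManifold (𝓡 4) ∞ M] [CompactSpace M] [ConnectedSpace M]
        [MeasurableSpace M] [BorelSpace M] (ι : M → EuclideanSpace ℝ (Fin 6)),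
        Manifold.IsSmoothEmbedding (𝓡 4) (𝓡 6) ∞ ι →
        (∀ x, ∑ i : Fin 5, ι x (Fin.castSucc i) ^ 2 = 1) →
        (∀ R : ℝ, ∃ a b : EuclideanSpace ℝ (Fin 6), ∑ i : Fin 5, a (Fin.castSucc i) ^ 2 = 1 ∧
          ∑ i : Fin 5, b (Fin.castSucc i) ^ 2 = 1 ∧ a 5 ≤ -R ∧ R ≤ b 5 ∧
          JoinedIn ({z : EuclideanSpace ℝ (Fin 6) | ∑ i : Fin 5, z (Fin.castSucc i) ^ 2 = 1} \ Set.range ι) a b) →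
        (∃ (z : EuclideanSpace ℝ (Fin 6)) (R : ℝ), ∑ i : Fin 5, z (Fin.castSucc i) ^ 2 = 1 ∧ z ∉ Set.range ι ∧
          ∀ b : EuclideanSpace ℝ (Fin 6), ∑ i : Fin 5, b (Fin.castSucc i) ^ 2 = 1 → b 5 ≤ -R →
            ¬ JoinedIn ({z : EuclideanSpace ℝ (Fin 6) | ∑ i : Fin 5, z (Fin.castSucc i) ^ 2 = 1} \ Set.range ι) z b) →
        ∀ ν : M → EuclideanSpace ℝ (Fin 6), Continuous ν →
        (euclideanMetric (EuclideanSpace ℝ (Fin 6))).IsUnitNormal (𝓡 4) ι ν 1 →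
        (∀ x, ∑ i : Fin 5, ν x (Fin.castSucc i) * ι x (Fin.castSucc i) = 0) →
        ∫ x, ν x 5 ∂(Measure.comap ι (μH[4] : Measure (EuclideanSpace ℝ (Fin 6)))) = 0) →
    ¬ ∃ (P : Type) (_ : TopologicalSpace P) (_ : T2Space P) (_ : SecondCountableTopology P)
        (_ : ChartedSpace (EuclideanSpace ℝ (Fin 4)) P) (_ : IsManifold (𝓡 4) ∞ P) (_ : CompactSpace P)
        (_ : ConnectedSpace P) (_ : MeasurableSpace P) (_ : BorelSpace P)
        (F : ℝ → P → EuclideanSpace ℝ (Fin 6)) (ν : ℝ → P → EuclideanSpace ℝ (Fin 6)) (T : ℝ),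
        IsCylinderMCF P F ν T ∧ (∀ t, T ≤ t → cylEntropy (Set.range (F t)) < 2) ∧
          (∀ t, T ≤ t → ¬ SeparatesEnds (Set.range (F t))) ∧
          (∀ t, T ≤ t → ∃ (z : EuclideanSpace ℝ (Fin 6)) (R : ℝ), ∑ i : Fin 5, z (Fin.castSucc i) ^ 2 = 1 ∧
            z ∉ Set.range (F t) ∧ ∀ b : EuclideanSpace ℝ (Fin 6), ∑ i : Fin 5, b (Fin.castSucc i) ^ 2 = 1 →
              b 5 ≤ -R → ¬ JoinedIn ({z : EuclideanSpace ℝ (Fin 6) | ∑ i : Fin 5, z (Fin.castSucc i) ^ 2 = 1} \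
                Set.range (F t)) z b) := by
  rintro hstatic hflux ⟨P, _, _, _, _, _, _, _, _, _, F, ν, T, hflow, hent, hnsep, hpocket⟩
  refine helper_nullSurvivorsDieOfStatic hstatic ⟨P, inferInstance, inferInstance, inferInstance, inferInstance,
    inferInstance, inferInstance, inferInstance, inferInstance, inferInstance, F, ν, T, hflow, hent, hnsep,
    fun t ht => ?_⟩
  exact hflux P (F t) (hflow.isSmoothEmbedding t ht) (hflow.mem_cyl t ht)
    (forall_joinedIn_of_not_separatesEnds (hnsep t ht)) (hpocket t ht) (ν t)
    (hflow.contMDiff_normal t ht).continuous (hflow.isUnitNormal t ht) (hflow.normal_tangent t ht)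

end Summit.SmoothPoincare4.SmoothPoincare4.Cruxes.CylinderRungTwo.KillingFlux

end
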